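import Summits.MatrixMultiplication.OmegaCensus.DominoZpZpStructSixKeys
import HarnessLib

/-!
# Structural cover argument for part size `7` on `ZMod p × ZMod p`: keys of septuples

ω-census `pub-omega`, family (b3), seat pub-omega-group gen 24 (part-`7` copy of gen 23's `DominoZpZpStructSixKeys.lean`).
Framing: lottery ticket; floor = certified bounds/negative ranges.  VALUE: bookkeeping for the part-`7` structural route
(`DominoZpZpStructSevenCore.lean`, aimed at the OPEN census cells `(1,7,23)@484` ×2, `p = 11`): count vectors `key7` of septuples
of line values, their entries as sums, permutation invariance, the unit-scaling law `key7 (κ·a) = scaleVec p κ.val (key7 a)`,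
the exclusion lemma used by the core (four equal values), the functional-to-direction transfer `good_of_lmap7`, the PIGEONHOLE
`exists_parallel_pairs7` (twenty-one index pairs, at most `p + 1 ≤ 20` slopes; `slope`/`lmap_eq_zero_of_slope_eq` are the part-`6`
ones), index permutations of `Fin 7`, and the compressed-table expansion for septuple keys (`expandEntry7`, `expandTable7`);
NOT progress on ω.
-/

namespace Summit.MatrixMultiplication.OmegaCensus

open Finset

namespace ZpZpDomino

section Keys

/-- The count function of a septuple of naturals. [folklore] -/
def cnt7 (n₀ n₁ n₂ n₃ n₄ n₅ n₆ v : ℕ) : ℕ :=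
  (if n₀ = v then 1 else 0) + (if n₁ = v then 1 else 0) + (if n₂ = v then 1 else 0) + (if n₃ = v then 1 else 0) +
    (if n₄ = v then 1 else 0) + (if n₅ = v then 1 else 0) + (if n₆ = v then 1 else 0)

/-- The count VECTOR (length `p`, digits `≤ 6`) of a septuple of naturals. [folklore] -/
def cv7 (p n₀ n₁ n₂ n₃ n₄ n₅ n₆ : ℕ) : List ℕ := (List.range p).map (cnt7 n₀ n₁ n₂ n₃ n₄ n₅ n₆)

/-- `cnt7 ≤ 6`. [folklore] -/
theorem cnt7_le (n₀ n₁ n₂ n₃ n₄ n₅ n₆ v : ℕ) : cnt7 n₀ n₁ n₂ n₃ n₄ n₅ n₆ v ≤ 7 := by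
  unfold cnt7; split_ifs <;> omega

/-- Length of a count vector. [folklore] -/
theorem length_cv7 (p n₀ n₁ n₂ n₃ n₄ n₅ n₆ : ℕ) : (cv7 p n₀ n₁ n₂ n₃ n₄ n₅ n₆).length = p := by simp [cv7]

/-- Entries of a count vector. [folklore] -/
theorem getD_cv7 (p n₀ n₁ n₂ n₃ n₄ n₅ n₆ : ℕ) {w : ℕ} (hw : w < p) :
    (cv7 p n₀ n₁ n₂ n₃ n₄ n₅ n₆).getD w 0 = cnt7 n₀ n₁ n₂ n₃ n₄ n₅ n₆ w := by
  simp [cv7, List.getD_eq_getElem?_getD, List.getElem?_range hw]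

variable {p : ℕ}

/-- The key (count vector of the values) of a septuple of line values. [folklore] -/
def key7 (a : Fin 7 → ZMod p) : List ℕ := cv7 p (a 0).val (a 1).val (a 2).val (a 3).val (a 4).val (a 5).val (a 6).val

/-- The count function as a sum over `Fin 7`. [folklore] -/
theorem cnt7_key7_eq_sum (a : Fin 7 → ZMod p) (v : ℕ) :
    cnt7 (a 0).val (a 1).val (a 2).val (a 3).val (a 4).val (a 5).val (a 6).val v = ∑ i : Fin 7, if (a i).val = v then 1 else 0 := by
  simp only [cnt7, Fin.sum_univ_seven]

/-- Length of a key. [folklore] -/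
theorem length_key7 (a : Fin 7 → ZMod p) : (key7 a).length = p := length_cv7 _ _ _ _ _ _ _ _

/-- Keys are invariant under permutations of the indices. [folklore] -/
theorem key7_perm (a : Fin 7 → ZMod p) (σ : Equiv.Perm (Fin 7)) : key7 (fun i => a (σ i)) = key7 a := by
  unfold key7 cv7
  refine List.map_congr_left fun v _ => ?_
  rw [cnt7_key7_eq_sum (fun i => a (σ i)), cnt7_key7_eq_sum a]
  exact Equiv.sum_comp σ (fun i => if (a i).val = v then 1 else 0)

/-- Entries of a key as a sum. [folklore] -/
theorem getD_key7 (a : Fin 7 → ZMod p) {w : ℕ} (hw : w < p) :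
    (key7 a).getD w 0 = ∑ i : Fin 7, if (a i).val = w then 1 else 0 := by
  rw [key7, getD_cv7 p _ _ _ _ _ _ _ hw, cnt7_key7_eq_sum]

variable [Fact p.Prime]

/-- A set of indices with equal values bounds the entry from below. [folklore] -/
theorem card_le_getD_key7 (a : Fin 7 → ZMod p) (i : Fin 7) (S : Finset (Fin 7)) (hS : ∀ k ∈ S, a k = a i) :
    S.card ≤ (key7 a).getD (a i).val 0 := by
  rw [getD_key7 a (ZMod.val_lt _)]
  have h : ∑ k ∈ S, (if (a k).val = (a i).val then 1 else 0) = S.card := by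
    rw [Finset.card_eq_sum_ones]
    exact Finset.sum_congr rfl fun k hk => by rw [hS k hk, if_pos rfl]
  exact le_trans (le_of_eq h.symm) (sum_le_sum_of_subset_of_nonneg (subset_univ _) fun _ _ _ => Nat.zero_le _)

/-- Every index gives an entry `≥ 1`. [folklore] -/
theorem one_le_getD_key7 (a : Fin 7 → ZMod p) (i : Fin 7) : 1 ≤ (key7 a).getD (a i).val 0 := by
  have := card_le_getD_key7 a i {i} (by simp)
  simpa using this

/-- The entry of a key at one of its values is a member of the key. [folklore] -/
theorem getD_key7_mem (a : Fin 7 → ZMod p) (i : Fin 7) : (key7 a).getD (a i).val 0 ∈ key7 a := by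
  have hw : (a i).val < (key7 a).length := by rw [length_key7]; exact ZMod.val_lt _
  rw [List.getD_eq_getElem?_getD, List.getElem?_eq_getElem hw, Option.getD_some]
  exact List.getElem_mem hw

/-- **Four equal values ⇒ not excluded** (entries of excluded keys are `≤ 3`). [folklore] -/
theorem key7_not_mem_of_four {E : List (List ℕ)} (hE1 : ∀ k ∈ E, ∀ x ∈ k, x ≤ 3) (a : Fin 7 → ZMod p)
    {i j k l : Fin 7} (hij : i ≠ j) (hik : i ≠ k) (hil : i ≠ l) (hjk : j ≠ k) (hjl : j ≠ l) (hkl : k ≠ l)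
    (e1 : a j = a i) (e2 : a k = a i) (e3 : a l = a i) : key7 a ∉ E := by
  intro hmem
  have h4 := card_le_getD_key7 a i {i, j, k, l} (by
    intro m hm; simp only [mem_insert, mem_singleton] at hm
    rcases hm with rfl | rfl | rfl | rfl <;> simp [e1, e2, e3])
  have hc : ({i, j, k, l} : Finset (Fin 7)).card = 4 := by
    rw [card_insert_of_notMem (by simp [hij, hik, hil]), card_insert_of_notMem (by simp [hjk, hjl]),
      card_insert_of_notMem (by simp [hkl]), card_singleton]
  have hle := hE1 _ hmem _ (getD_key7_mem a i)
  omega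

/-- **Keys of unit multiples are unit scalings**: `key7 (κ·a) = scaleVec p κ.val (key7 a)`. [folklore] -/
theorem key7_smul {κ : ZMod p} (hκ : κ ≠ 0) (a : Fin 7 → ZMod p) :
    key7 (fun i => κ * a i) = scaleVec p κ.val (key7 a) := by
  unfold scaleVec
  rw [key7, cv7]
  refine List.map_congr_left fun w hw => ?_
  rw [List.mem_range] at hw
  have hidx : invMod p κ.val * w % p = (κ⁻¹ * ((w : ℕ) : ZMod p)).val := by
    have e : ((invMod p κ.val * w % p : ℕ) : ZMod p) = κ⁻¹ * ((w : ℕ) : ZMod p) := by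
      rw [ZMod.natCast_mod, Nat.cast_mul, natCast_invMod hκ]
    have := congrArg ZMod.val e
    rwa [ZMod.val_natCast, Nat.mod_mod] at this
  rw [hidx, key7, getD_cv7 p _ _ _ _ _ _ _ (ZMod.val_lt _)]
  unfold cnt7
  have hiff : ∀ i : Fin 7, ((κ * a i).val = w) ↔ ((a i).val = (κ⁻¹ * ((w : ℕ) : ZMod p)).val) := by
    intro i
    constructor
    · intro h
      have e : κ * a i = ((w : ℕ) : ZMod p) := by
        apply ZMod.val_injective p; rw [h, ZMod.val_natCast, Nat.mod_eq_of_lt hw]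
      rw [← e, inv_mul_cancel_left₀ hκ]
    · intro h
      have e : a i = κ⁻¹ * ((w : ℕ) : ZMod p) := by
        apply ZMod.val_injective p; rw [h]
      rw [e, mul_inv_cancel_left₀ hκ, ZMod.val_natCast, Nat.mod_eq_of_lt hw]
  simp only [hiff]

/-- `key7 (κ·a) ∈ E → key7 a ∈ E` for `κ ≠ 0` (closure under unit scalings). [folklore] -/
theorem key7_mem_of_smul_mem {E : List (List ℕ)} (hE2 : ∀ k ∈ E, ∀ κ : ℕ, 1 ≤ κ → κ < p → scaleVec p κ k ∈ E)
    {κ : ZMod p} (hκ : κ ≠ 0) (a : Fin 7 → ZMod p) (h : key7 (fun i => κ * a i) ∈ E) : key7 a ∈ E := by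
  have hκ' : κ⁻¹ ≠ 0 := inv_ne_zero hκ
  have h1 := hE2 _ h (κ⁻¹).val (Nat.one_le_iff_ne_zero.2 ((ZMod.val_ne_zero _).2 hκ')) (ZMod.val_lt _)
  rw [← key7_smul hκ'] at h1
  have e : (fun i => κ⁻¹ * (κ * a i)) = a := funext fun i => by rw [inv_mul_cancel_left₀ hκ]
  rwa [e] at h1

/-- `key7 a ∈ E → key7 (κ·a) ∈ E`. [folklore] -/
theorem key7_smul_mem {E : List (List ℕ)} (hE2 : ∀ k ∈ E, ∀ κ : ℕ, 1 ≤ κ → κ < p → scaleVec p κ k ∈ E)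
    {κ : ZMod p} (hκ : κ ≠ 0) (a : Fin 7 → ZMod p) (h : key7 a ∈ E) : key7 (fun i => κ * a i) ∈ E := by
  rw [key7_smul hκ]
  exact hE2 _ h κ.val (Nat.one_le_iff_ne_zero.2 ((ZMod.val_ne_zero _).2 hκ)) (ZMod.val_lt _)

end Keys

section Functionals

variable {p : ℕ} [Fact p.Prime]

/-- **From a good functional to a good direction** (part `7`). [folklore] -/
theorem good_of_lmap7 {E : List (List ℕ)} (hE2 : ∀ k ∈ E, ∀ κ : ℕ, 1 ≤ κ → κ < p → scaleVec p κ k ∈ E)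
    (u : Fin 7 → ZMod p × ZMod p) (c₁ c₂ : ZMod p) (hc : c₁ ≠ 0 ∨ c₂ ≠ 0) (σ : Equiv.Perm (Fin 7))
    (hcoin : lmap c₁ c₂ (u (σ 0)) = lmap c₁ c₂ (u (σ 1))) (hkey : key7 (fun k => lmap c₁ c₂ (u k)) ∉ E) :
    ∃ j < p + 1, ∃ σ : Equiv.Perm (Fin 7), lineDir p j (u (σ 0)) = lineDir p j (u (σ 1)) ∧
      key7 (fun i => lineDir p j (u (σ i))) ∉ E := by
  obtain ⟨j, hj, κ, hκ, hφ⟩ := exists_lineDir_of_lmap c₁ c₂ hc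
  refine ⟨j, hj, σ, ?_, fun hmem => hkey ?_⟩
  · have := hcoin
    rw [hφ, hφ] at this
    exact (mul_right_inj' hκ).1 this
  · have e : (fun k => lmap c₁ c₂ (u (σ k))) = fun k => κ * lineDir p j (u (σ k)) := funext fun k => hφ _
    have h1 : key7 (fun k => lmap c₁ c₂ (u (σ k))) ∈ E := by rw [e]; exact key7_smul_mem hE2 hκ _ hmem
    have h2 := key7_perm (fun k => lmap c₁ c₂ (u k)) σ
    rw [h2] at h1
    exact h1

/-- The twenty-one index pairs `i < j` of `Fin 7` outnumber the `p + 1 ≤ 20` slopes: **two distinct pairs have parallel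
differences.** [folklore] -/
theorem exists_parallel_pairs7 (hp : p + 1 < 21) (u : Fin 7 → ZMod p × ZMod p) :
    ∃ q q' : {q : Fin 7 × Fin 7 // q.1 < q.2}, q ≠ q' ∧
      lmap (u q.1.1 - u q.1.2).2 (-(u q.1.1 - u q.1.2).1) (u q'.1.1 - u q'.1.2) = 0 := by
  haveI : NeZero p := ⟨(Fact.out : p.Prime).ne_zero⟩
  have hcard : Fintype.card (Option (ZMod p)) < Fintype.card {q : Fin 7 × Fin 7 // q.1 < q.2} := by
    rw [Fintype.card_option, ZMod.card]
    have : Fintype.card {q : Fin 7 × Fin 7 // q.1 < q.2} = 21 := by decide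
    rw [this]; exact hp
  obtain ⟨q, q', hne, heq⟩ := Fintype.exists_ne_map_eq_of_card_lt (fun q : {q : Fin 7 × Fin 7 // q.1 < q.2} =>
    slope (u q.1.1 - u q.1.2)) hcard
  exact ⟨q, q', hne, lmap_eq_zero_of_slope_eq heq⟩

/-- A permutation of `Fin 7` with prescribed distinct values at `0, 1, 2`. [folklore] -/
def triPerm7 (i j k : Fin 7) : Equiv.Perm (Fin 7) :=
  let σ₁ := Equiv.swap (0 : Fin 7) i
  let σ₂ := (Equiv.swap (1 : Fin 7) (σ₁ j)).trans σ₁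
  (Equiv.swap (2 : Fin 7) (σ₂.symm k)).trans σ₂

/-- Values of `triPerm7`. [folklore] -/
theorem triPerm7_apply : ∀ i j k : Fin 7, i ≠ j → i ≠ k → j ≠ k →
    triPerm7 i j k 0 = i ∧ triPerm7 i j k 1 = j ∧ triPerm7 i j k 2 = k := by decide

/-- A permutation of `Fin 7` with prescribed distinct values at `0, 1, 2, 3`. [folklore] -/
def quadPerm7 (i j k l : Fin 7) : Equiv.Perm (Fin 7) :=
  let σ₃ := triPerm7 i j k
  (Equiv.swap (3 : Fin 7) (σ₃.symm l)).trans σ₃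

/-- Values of `quadPerm7`. [folklore] -/
theorem quadPerm7_apply : ∀ i j k l : Fin 7, i ≠ j → i ≠ k → i ≠ l → j ≠ k → j ≠ l → k ≠ l →
    quadPerm7 i j k l 0 = i ∧ quadPerm7 i j k l 1 = j ∧ quadPerm7 i j k l 2 = k ∧ quadPerm7 i j k l 3 = l := by decide

/-- A permutation of `Fin 7` with prescribed distinct values at `0, 1`. [folklore] -/
def pairPerm7 (i j : Fin 7) : Equiv.Perm (Fin 7) := (Equiv.swap 1 (Equiv.swap 0 i j)).trans (Equiv.swap 0 i)

/-- Values of `pairPerm7`. [folklore] -/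
theorem pairPerm7_apply : ∀ i j : Fin 7, i ≠ j → pairPerm7 i j 0 = i ∧ pairPerm7 i j 1 = j := by decide

end Functionals

/-! ## Table format (compressed, septuple keys) -/

/-- Expansion of a compressed table entry with a septuple key. [folklore] -/
def expandEntry7 (q : ℕ)
    (e : (ℕ × ℕ × ℕ × ℕ × ℕ × ℕ × ℕ) × (List (ℕ × ℕ × ℕ × ℕ) × List (ℕ × ℕ × ℕ × ℕ × ℕ × ℕ) × List (ℕ × List ℕ))) :
    List ℕ × List (ℕ × List ℕ) :=
  (cv7 q e.1.1 e.1.2.1 e.1.2.2.1 e.1.2.2.2.1 e.1.2.2.2.2.1 e.1.2.2.2.2.2.1 e.1.2.2.2.2.2.2,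
    e.2.1.map (expandCC q) ++ (e.2.2.1.map (expandCC2 q) ++ e.2.2.2))

/-- Expansion of a compressed table with septuple keys. [folklore] -/
def expandTable7 (q : ℕ)
    (T : List ((ℕ × ℕ × ℕ × ℕ × ℕ × ℕ × ℕ) × (List (ℕ × ℕ × ℕ × ℕ) × List (ℕ × ℕ × ℕ × ℕ × ℕ × ℕ) × List (ℕ × List ℕ)))) :
    List (List ℕ × List (ℕ × List ℕ)) :=
  T.map (expandEntry7 q)

end ZpZpDomino

end Summit.MatrixMultiplication.OmegaCensus
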